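import Literature.AlgebraicGeometry.ShimuraVarieties.HeckeCorrespondenceAction
import Literature.Topology.CoveringSpaces.OrbitQuotientCovering

/-!
# Level covers of a ball quotient are covering maps, GIVEN that `Γ` acts freely and properly
# discontinuously on the ball (crux `EndoscopicMiddleDegree.OrthogonalEnveloped`, stmt-HodgeConjecture-14300;
# `--supports`; third lead lineage, seat c2, 2026-08-16)

The one residual construction of the crux chain after the Chow / analytic-support reshape
(`Theorems/…HeckeGraphChow`) is the analyticity of the Hecke graphs (registered stub
`stub_heckeGraphAnalytic`), whose first formal prerequisite — absent from the tree as a statement — is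

  (G1) `Γ` acts FREELY and PROPERLY DISCONTINUOUSLY on the ball `𝔹` (BMM Part 2 §1.4: `K` neat, `Γ`
       torsion free; Borel 1969 §8: arithmetic subgroups are discrete, discrete subgroups of `U(p,1) ×`
       compact act properly on the symmetric space), and `𝔹 = negCone / ℂˣ` is locally compact Hausdorff.

This file pins the Lean shape of (G1) as typeclass hypotheses on the tree's objects
(`ProperlyDiscontinuousSMul ↥D.Γ D.ball`, `IsCancelSMul ↥D.Γ D.ball`, `LocallyCompactSpace D.ball`,
`T2Space D.ball`) and PROVES from them, with the tree's intermediate-quotient covering theorem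
`Literature.Topology.CoveringSpaces.OrbitQuotient.isCoveringMap_lift` (fed with the PROVED
`isOpenQuotientMap_ballUnif` and `ballUnif_eq_iff`):

* `stub_levelCoveringOfProperlyDiscontinuous` (REGISTERED stub of the crux) — every level cover
  `N \ 𝔹 → X(ℂ)`, `N ⊴ Γ`, is a covering map;
* `isHeckeAdmissible_of_properlyDiscontinuous` — hence `g ∈ U(V)(F)` with `[Γ : N_g] < ∞` is Hecke
  admissible (the covering clause of `IsHeckeAdmissible` discharged; the finite-index clause is
  elementary arithmetic of congruence subgroups, not done here).

So (G1), once proved or recorded as fields of the datum, discharges the covering hypotheses of the whole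
Hecke vocabulary (`IsHeckeAdmissible.isCoveringMap`) and is the input of `stub_heckeGraphAnalytic`.

References: BMM arXiv:1306.1515 Part 2 §1.4; A. Borel, *Introduction aux groupes arithmétiques* (1969) §8;
Hatcher §1.3 Prop. 1.40.
-/

noncomputable section

-- The crux-workfile namespace `Summit.<P>.<Sub>.Cruxes.…` repeats `HodgeConjecture` (single-conjunct summit).
set_option linter.dupNamespace false

namespace Summit.HodgeConjecture.HodgeConjecture.Cruxes.OrthogonalEnveloped.HeckeGraphChow

open Literature.AlgebraicGeometry.Motives (SchemeOver ComplexPoints)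
open Literature.AlgebraicGeometry.ShimuraVarieties
open Literature.Topology.CoveringSpaces

/-- **REGISTERED STUB `stub_levelCoveringOfProperlyDiscontinuous` (seat c2): level covers are covering
maps, given (G1).** For a ball-quotient datum `D` such that `Γ` acts properly discontinuously
(`ProperlyDiscontinuousSMul`) and freely (`IsCancelSMul`) on the locally compact Hausdorff ball
`D.ball`, and every normal subgroup `N ⊴ Γ`, the level projection `N \ 𝔹 → X(ℂ)` is a covering map:
`𝔹 → X(ℂ)` is an open quotient map with the `Γ`-orbits as fibres (`isOpenQuotientMap_ballUnif`,
`ballUnif_eq_iff`, proved from the datum), so the intermediate quotient is a covering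
(`OrbitQuotient.isCoveringMap_lift`). [cite: BergeronMillsonMoeglin2016Balls, Part 2 §1.4]
[cite: HatcherAT2002, §1.3 Prop. 1.40] -/
theorem stub_levelCoveringOfProperlyDiscontinuous :
    ∀ {p : ℕ} {X : SchemeOver ℂ} (D : UnitaryBallQuotientDatum p X)
      [ProperlyDiscontinuousSMul ↥D.Γ D.ball] [IsCancelSMul ↥D.Γ D.ball]
      [LocallyCompactSpace D.ball] [T2Space D.ball] (N : Subgroup ↥D.Γ) [N.Normal],
      IsCoveringMap (D.levelProj N) := by
  intro p X D _ _ _ _ N _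
  exact OrbitQuotient.isCoveringMap_lift N D.isOpenQuotientMap_ballUnif.isQuotientMap
    (fun {x y} ↦ D.ballUnif_eq_iff x y) (fbar := D.levelProj N) (fun _ ↦ rfl)

/-- **Hecke admissibility from (G1)**: for a datum as above, an isometry `g ∈ U(V)(F)` whose Hecke level
`N_g` has finite index in `Γ` is admissible — the covering clause of `IsHeckeAdmissible` holds by
`stub_levelCoveringOfProperlyDiscontinuous`. [cite: Shimura1973, §3.1 and §7.2]
[cite: BergeronMillsonMoeglin2016Balls, Part 2 §1.4] -/
theorem isHeckeAdmissible_of_properlyDiscontinuous {p : ℕ} {X : SchemeOver ℂ}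
    (D : UnitaryBallQuotientDatum p X) [ProperlyDiscontinuousSMul ↥D.Γ D.ball]
    [IsCancelSMul ↥D.Γ D.ball] [LocallyCompactSpace D.ball] [T2Space D.ball]
    {g : GL (Fin (p + 1)) D.E} (hg : g ∈ unitaryGroup (conjRingHom D.E) D.H)
    (hfin : (D.heckeLevel g).FiniteIndex) : D.IsHeckeAdmissible g :=
  ⟨hg, hfin, stub_levelCoveringOfProperlyDiscontinuous D (D.heckeLevel g)⟩

end Summit.HodgeConjecture.HodgeConjecture.Cruxes.OrthogonalEnveloped.HeckeGraphChow

end
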